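import Literature.Analysis.FluidPDE.RenormalizedDiffusivityCascadeGeneral
import Literature.Analysis.FluidPDE.RenormalizedDiffusivityCascadeStability
import HarnessLib

/-!
# Armstrong–Vicol, Lemma 3.4 ((3.45), perturbed cascades) on the printed scales for every `q > 1`

Companion to `RenormalizedDiffusivityCascadeGeneral.lean` (Step 1 with the (2.10)-constant as a
parameter) and `RenormalizedDiffusivityCascadeStability.lean` (Step 2) — S. Armstrong, V. Vicol,
arXiv:2305.05048v3 = Ann. PDE 11 (2025), Lemma 3.4 p. 43, proof pp. 44–45 [cite: ArmstrongVicol2025]: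
theorems only, no new facts or definitions.

* `perturbedDiffusivity_close_general` — Step 2 ((3.56)–(3.59)) with only positivity and the
  minimal scale separation (2.9) as hypotheses on the scales (the proof of
  `perturbedDiffusivity_close` uses nothing else; verbatim).
* `perturbedDiffusivity_bounds_general` — (3.45) for perturbed cascades with the (2.10)-constant `Κ`
  as a parameter.
* `perturbedDiffusivity_bounds_scaleSeq_all` — (3.45) for perturbed cascades over the PRINTED
  scales `εₘ = ⌈Λ^{q^m/(q-1)}⌉⁻¹` for EVERY `q > 1` and all `Λ ≥ Λ₀(β, q, σ, C₀)`, removing the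
  restriction `q < 10` (`β > 40/39`) under which alone the printed scales satisfy `IsScaleSequence`.
-/

open Real

namespace Literature.Analysis.FluidPDE

namespace ArmstrongVicol2025

/-- **Armstrong–Vicol, Lemma 3.4, Step 2 ((3.56)–(3.59) p. 45) without the (2.10) hypothesis.**
The stability of the cascade (`perturbedDiffusivity_close`) uses, of the scale sequence, only
positivity and the minimal scale separation `εₘ/εₘ₊₁ ≥ 2⁷` ((2.9)) — here these are the only
hypotheses (no super-geometric bound (2.10), no exponent `q`), so the statement applies to the
printed scales for every `q > 1`. Same constants and the same proof, verbatim.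
[cite: ArmstrongVicol2025, Lemma 3.4, proof Step 2, (3.56)–(3.59) p. 45] -/
theorem perturbedDiffusivity_close_general {σ C₀ : ℝ} (hσ : 0 < σ) (hC₀ : 0 ≤ C₀) :
    ∃ η : ℝ, 0 < η ∧
      ∀ ε : ℕ → ℝ, (∀ m, 0 < ε m) → (∀ m, 2 ^ 7 * ε (m + 1) ≤ ε m) → ε 1 ≤ η →
      ∀ (a : ℕ → ℝ) (M : ℕ) (κ₀ : ℝ), 0 < κ₀ →
      ∀ κ : ℕ → ℝ, (∀ n, 0 < κ n) → κ M = κ₀ →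
        (∀ n, 1 ≤ n → n + 1 ≤ M →
          modelDiffusivity a ε M κ₀ (n + 1) / 2 ≤ κ (n + 1) →
          κ (n + 1) ≤ 2 * modelDiffusivity a ε M κ₀ (n + 1) →
          |κ n - enhanceStep (a (n + 1)) (ε (n + 1)) (κ (n + 1))| ≤
            C₀ * ε n ^ σ * enhanceStep (a (n + 1)) (ε (n + 1)) (κ (n + 1))) →
        ∀ m, 1 ≤ m → m ≤ M →
          modelDiffusivity a ε M κ₀ m / 2 ≤ κ m ∧ κ m ≤ 2 * modelDiffusivity a ε M κ₀ m := by
  -- constants: `K = 2C₀`, `ρ = 2^{-7σ}`, threshold `t` on `ε₁^σ`, `η = t^{1/σ}`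
  set K := 2 * C₀ with hK
  have hK0 : 0 ≤ K := by rw [hK]; linarith
  set ρ := (((2 : ℝ) ^ 7)⁻¹) ^ σ with hρ
  have hρ1 : ρ < 1 := rpow_lt_one (by positivity) (by norm_num) hσ
  have h1ρ : 0 < 1 - ρ := by linarith
  have hlog2 : 0 < log 2 := log_pos one_lt_two
  set t := min (1 / (2 * C₀ + 2)) ((1 - ρ) * log 2 / (K + 1)) with ht
  have htpos : 0 < t := lt_min (by positivity) (by positivity)
  have ht1 : t ≤ 1 / (2 * C₀ + 2) := min_le_left _ _
  have ht2 : t ≤ (1 - ρ) * log 2 / (K + 1) := min_le_right _ _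
  set η := t ^ (1 / σ) with hη
  have hηpos : 0 < η := rpow_pos_of_pos htpos _
  have hησ : η ^ σ = t := by
    rw [hη, ← rpow_mul htpos.le, one_div_mul_cancel hσ.ne', rpow_one]
  refine ⟨η, hηpos, ?_⟩
  intro ε εpos hratio7 hε1 a M κ₀ hκ₀ κ κpos hκM hstep m hm1 hmM
  have hsucc_le : ∀ n, ε (n + 1) ≤ ε n := fun n => by
    have := hratio7 n; have := εpos (n + 1); nlinarith
  have hsucc_le_mul : ∀ n, ε (n + 1) ≤ ((2 : ℝ) ^ 7)⁻¹ * ε n := fun n => by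
    have h1 := hratio7 n
    rw [inv_mul_eq_div, le_div_iff₀ (by positivity)]
    linarith
  -- `εₙ^σ ≤ t` for `n ≥ 1`
  have hεσ : ∀ n, 1 ≤ n → ε n ^ σ ≤ t := by
    intro n hn
    have hle : ε n ≤ ε 1 := by
      induction n with
      | zero => omega
      | succ n ih =>
        rcases Nat.lt_or_ge n 1 with h | h
        · have : n = 0 := by omega
          subst this; exact le_rfl
        · exact (hsucc_le n).trans (ih h)
    calc ε n ^ σ ≤ η ^ σ := rpow_le_rpow (εpos n).le (hle.trans hε1) hσ.le
      _ = t := hησ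
  -- the model cascade and the ratio to it
  obtain ⟨k, hk⟩ : ∃ k : ℕ → ℝ, ∀ n, k n = modelDiffusivity a ε M κ₀ n := ⟨_, fun _ => rfl⟩
  have kpos : ∀ n, 0 < k n := fun n => by rw [hk]; exact modelDiffusivity_pos hκ₀ n
  obtain ⟨R, hR⟩ : ∃ R : ℕ → ℝ, ∀ n, R n = max (κ n / k n) (k n / κ n) := ⟨_, fun _ => rfl⟩
  have hR1 : ∀ n, 1 ≤ R n := by
    intro n; rw [hR]
    rcases le_or_gt (k n) (κ n) with h | h
    · exact le_max_of_le_left ((one_le_div (kpos n)).mpr h)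
    · exact le_max_of_le_right ((one_le_div (κpos n)).mpr h.le)
  have hR0 : ∀ n, 0 ≤ R n := fun n => zero_le_one.trans (hR1 n)
  have hRM : R M = 1 := by
    rw [hR, hk, modelDiffusivity_top, hκM, div_self hκ₀.ne', max_self]
  -- from `R ≤ 2` to the inductive range (3.56)
  have hrange : ∀ n, R n ≤ 2 → k n / 2 ≤ κ n ∧ κ n ≤ 2 * k n := by
    intro n h
    rw [hR] at h
    have h1 : κ n / k n ≤ 2 := (le_max_left _ _).trans h
    have h2 : k n / κ n ≤ 2 := (le_max_right _ _).trans h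
    rw [div_le_iff₀ (kpos n)] at h1
    rw [div_le_iff₀ (κpos n)] at h2
    constructor <;> linarith
  -- the one-step ratio bound: `Rₙ ≤ exp(K εₙ^σ) Rₙ₊₁` while `Rₙ₊₁ ≤ 2`
  have hone : ∀ n, 1 ≤ n → n + 1 ≤ M → R (n + 1) ≤ 2 → R n ≤ exp (K * ε n ^ σ) * R (n + 1) := by
    intro n hn1 hn hRn
    obtain ⟨hlo, hhi⟩ := hrange (n + 1) hRn
    rw [hk] at hlo hhi
    have hst := hstep n hn1 hn hlo hhi
    set E := enhanceStep (a (n + 1)) (ε (n + 1)) (κ (n + 1)) with hEdef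
    set E' := enhanceStep (a (n + 1)) (ε (n + 1)) (k (n + 1)) with hE'def
    have hEpos : 0 < E := enhanceStep_pos (κpos _)
    have hE'pos : 0 < E' := enhanceStep_pos (kpos _)
    have hkn : k n = E' := by rw [hE'def, hk, hk]; exact modelDiffusivity_succ hn
    have hθ0 : 0 ≤ C₀ * ε n ^ σ := mul_nonneg hC₀ (rpow_pos_of_pos (εpos n) _).le
    have hθ : C₀ * ε n ^ σ ≤ 1 / 2 := by
      have h1 := hεσ n hn1
      have h2 : C₀ * t ≤ 1 / 2 := by
        calc C₀ * t ≤ C₀ * (1 / (2 * C₀ + 2)) := mul_le_mul_of_nonneg_left ht1 hC₀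
          _ ≤ 1 / 2 := by
              rw [mul_one_div, div_le_div_iff₀ (by positivity) (by norm_num)]; nlinarith
      exact (mul_le_mul_of_nonneg_left h1 hC₀).trans h2
    -- `max{κₙ/E, E/κₙ} ≤ exp(2 C₀ εₙ^σ)` and `max{E/E', E'/E} ≤ Rₙ₊₁`
    have hA := max_div_le_exp_of_abs_sub_le hEpos hθ0 hθ hst
    have hB : max (E / E') (E' / E) ≤ R (n + 1) := by
      rw [hR]; exact enhanceStep_ratio_le (κpos _) (kpos _)
    have hexp0 : 0 ≤ exp (2 * (C₀ * ε n ^ σ)) := (exp_pos _).le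
    -- `κₙ/κ'ₙ = (κₙ/E)(E/E')` and `κ'ₙ/κₙ = (E/κₙ)(E'/E)`
    rw [hR n, hkn]
    have hKe : exp (K * ε n ^ σ) = exp (2 * (C₀ * ε n ^ σ)) := by rw [hK]; ring_nf
    rw [hKe]
    refine max_le ?_ ?_
    · calc κ n / E' = κ n / E * (E / E') := by field_simp
        _ ≤ exp (2 * (C₀ * ε n ^ σ)) * R (n + 1) :=
            mul_le_mul ((le_max_left _ _).trans hA) ((le_max_left _ _).trans hB)
              (div_pos hEpos hE'pos).le hexp0
    · calc E' / κ n = E / κ n * (E' / E) := by field_simp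
        _ ≤ exp (2 * (C₀ * ε n ^ σ)) * R (n + 1) :=
            mul_le_mul ((le_max_right _ _).trans hA) ((le_max_right _ _).trans hB)
              (div_pos hE'pos hEpos).le hexp0
  -- the cascade (3.58) with barrier `B = 2`
  have hdec : ∀ n, ε (n + 1) ^ σ ≤ ρ * ε n ^ σ := fun n => by
    rw [hρ, ← mul_rpow (by positivity) (εpos n).le]
    exact rpow_le_rpow (εpos _).le (hsucc_le_mul n) hσ.le
  have hB : R M * exp (K / (1 - ρ) * ε 1 ^ σ) ≤ 2 := by
    rw [hRM, one_mul]
    have h1 : K / (1 - ρ) * ε 1 ^ σ ≤ log 2 := by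
      rcases Nat.lt_or_ge M 1 with hM | hM
      · omega
      have := hεσ 1 le_rfl
      calc K / (1 - ρ) * ε 1 ^ σ ≤ K / (1 - ρ) * t :=
            mul_le_mul_of_nonneg_left this (div_nonneg hK0 h1ρ.le)
        _ ≤ K / (1 - ρ) * ((1 - ρ) * log 2 / (K + 1)) :=
            mul_le_mul_of_nonneg_left ht2 (div_nonneg hK0 h1ρ.le)
        _ = K / (K + 1) * log 2 := by field_simp
        _ ≤ 1 * log 2 := by
            apply mul_le_mul_of_nonneg_right _ hlog2.le
            rw [div_le_one (by linarith)]; linarith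
        _ = log 2 := one_mul _
    calc exp (K / (1 - ρ) * ε 1 ^ σ) ≤ exp (log 2) := exp_le_exp.mpr h1
      _ = 2 := exp_log two_pos
  have hcas := cascade_bound_of_le (L := R) (e := fun n => ε n ^ σ) (N := M) (B := 2) hK0 hρ1
    hR0 (fun n => (rpow_pos_of_pos (εpos n) _).le) hdec hB hone m hm1 hmM
  -- conclude: `R m ≤ 2`
  have hRm : R m ≤ 2 := by
    refine hcas.trans (le_trans ?_ hB)
    refine mul_le_mul_of_nonneg_left (exp_le_exp.mpr ?_) (hR0 M)
    refine mul_le_mul_of_nonneg_left ?_ (div_nonneg hK0 h1ρ.le)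
    have hle : ε m ≤ ε 1 := by
      clear hcas hmM
      induction m with
      | zero => omega
      | succ n ih =>
        rcases Nat.lt_or_ge n 1 with h | h
        · have : n = 0 := by omega
          subst this; exact le_rfl
        · exact (hsucc_le n).trans (ih h)
    exact rpow_le_rpow (εpos m).le hle hσ.le
  have := hrange m hRm
  rw [hk] at this
  exact this


/-- **Lemma 3.4 ((3.45) p. 43) for perturbed cascades, with the (2.10)-constant `Κ` as a parameter**
(`modelDiffusivity_bounds_general` + `perturbedDiffusivity_close_general`): for `β > 0`, `q > 1`,
`Κ ≥ 0`, `σ > 0`, `C₀ ≥ 0` there are `0 < c ≤ C` and `η > 0` such that for every positive sequence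
`ε` with `ε₀ = 1`, (2.9) with `2⁷`, (2.10) with constant `Κ` for `m ≥ 1`, `Κ εₘ ≤ 10/128` (`m ≥ 1`)
and `ε₁ ≤ η`, every positive sequence `κₘ` started in the window (3.44) at the critical scale `M`
and obeying the relative one-step estimate (3.57) on the inductive range satisfies
`c aₘ εₘ^{2+γ} ≤ κₘ ≤ C aₘ εₘ^{2+γ}` for `1 ≤ m ≤ M - 1`.
[cite: ArmstrongVicol2025, Lemma 3.4 (3.45) p. 43, proof pp. 44–45] -/
theorem perturbedDiffusivity_bounds_general {β q Κ σ C₀ : ℝ} (hβ : 0 < β) (hq : 1 < q)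
    (hΚ : 0 ≤ Κ) (hσ : 0 < σ) (hC₀ : 0 ≤ C₀) :
    ∃ c C η : ℝ, 0 < c ∧ c ≤ C ∧ 0 < η ∧
      ∀ ε : ℕ → ℝ, (∀ m, 0 < ε m) → ε 0 = 1 → (∀ m, 2 ^ 7 * ε (m + 1) ≤ ε m) →
        (∀ m, 1 ≤ m →
          (1 - Κ * ε m) * ε m ^ q ≤ ε (m + 1) ∧ ε (m + 1) ≤ (1 + Κ * ε m) * ε m ^ q) →
        (∀ m, 1 ≤ m → Κ * ε m ≤ 10 / 128) → ε 1 ≤ η → ∀ (M : ℕ) (κ₀ : ℝ),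
        ε M ^ (2 * β / (q + 1)) / 2 ≤ κ₀ → κ₀ ≤ 2 * ε M ^ (2 * β / (q + 1)) →
      ∀ κ : ℕ → ℝ, (∀ n, 0 < κ n) → κ M = κ₀ →
        (∀ n, 1 ≤ n → n + 1 ≤ M →
          modelDiffusivity (fun j => ε j ^ (β - 2)) ε M κ₀ (n + 1) / 2 ≤ κ (n + 1) →
          κ (n + 1) ≤ 2 * modelDiffusivity (fun j => ε j ^ (β - 2)) ε M κ₀ (n + 1) →
          |κ n - enhanceStep (ε (n + 1) ^ (β - 2)) (ε (n + 1)) (κ (n + 1))| ≤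
            C₀ * ε n ^ σ * enhanceStep (ε (n + 1) ^ (β - 2)) (ε (n + 1)) (κ (n + 1))) →
        ∀ m : ℕ, 1 ≤ m → m < M →
          c * (ε m ^ (β - 2) * ε m ^ (2 + gammaExp β q)) ≤ κ m ∧
            κ m ≤ C * (ε m ^ (β - 2) * ε m ^ (2 + gammaExp β q)) := by
  obtain ⟨c, C, hc, hcC, h1⟩ := modelDiffusivity_bounds_general hβ hq hΚ
  obtain ⟨η, hη, h2⟩ := perturbedDiffusivity_close_general hσ hC₀
  refine ⟨c / 2, 2 * C, η, by positivity, by linarith, hη, ?_⟩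
  intro ε εpos hε0 hratio7 hsuper hsmall hε1 M κ₀ hκ1 hκ2 κ κpos hκM hstep m hm1 hmM
  have hκ₀ : 0 < κ₀ := lt_of_lt_of_le (by have := εpos M; positivity) hκ1
  obtain ⟨hlo, hhi⟩ := h1 ε εpos hε0 hratio7 hsuper hsmall M κ₀ hκ1 hκ2 m hm1 hmM
  obtain ⟨hlo', hhi'⟩ :=
    h2 ε εpos hratio7 hε1 (fun j => ε j ^ (β - 2)) M κ₀ hκ₀ κ κpos hκM hstep m hm1 hmM.le
  have hP : 0 ≤ ε m ^ (β - 2) * ε m ^ (2 + gammaExp β q) := by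
    have := εpos m; positivity
  constructor
  · calc c / 2 * (ε m ^ (β - 2) * ε m ^ (2 + gammaExp β q))
          = c * (ε m ^ (β - 2) * ε m ^ (2 + gammaExp β q)) / 2 := by ring
      _ ≤ modelDiffusivity (fun j => ε j ^ (β - 2)) ε M κ₀ m / 2 := by linarith
      _ ≤ κ m := hlo'
  · calc κ m ≤ 2 * modelDiffusivity (fun j => ε j ^ (β - 2)) ε M κ₀ m := hhi'
      _ ≤ 2 * (C * (ε m ^ (β - 2) * ε m ^ (2 + gammaExp β q))) := by linarith
      _ = 2 * C * (ε m ^ (β - 2) * ε m ^ (2 + gammaExp β q)) := by ring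

/-! ### On the printed scales, for every `q > 1` and all large `Λ` -/

section Scales

variable {q : ℝ}

/-- **Lemma 3.4 ((3.45)) for perturbed cascades on the PRINTED scales (2.8), every `q > 1`, all
large minimal scale separations.** For `β > 0`, `q > 1`, `σ > 0`, `C₀ ≥ 0` there are `0 < c ≤ C`
and a threshold `Λ₀` (depending on `β, q, σ, C₀`) such that for every `Λ ∈ ℕ` with `Λ ≥ Λ₀`,
over `εₘ = ⌈Λ^{q^m/(q-1)}⌉⁻¹`, every positive sequence `κₘ` started in the window (3.44) at the
critical scale `M` and obeying (3.57) on the inductive range satisfies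
`c aₘ εₘ^{2+γ} ≤ κₘ ≤ C aₘ εₘ^{2+γ}` for `1 ≤ m ≤ M - 1` — the paper's "minimal scale separation
… chosen to depend only on `β`" (p. 19) together with "for some `n₀(data)`" (p. 45); no
restriction `q < 10` (contrast `perturbedDiffusivity_bounds`, whose `IsScaleSequence` hypothesis
the printed scales meet only for `q < 10`).
[cite: ArmstrongVicol2025, §2.1 (2.8)–(2.10) p. 19; Lemma 3.4 (3.45) p. 43, proof pp. 44–45] -/
theorem perturbedDiffusivity_bounds_scaleSeq_all {β σ C₀ : ℝ} (hβ : 0 < β) (hq : 1 < q)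
    (hσ : 0 < σ) (hC₀ : 0 ≤ C₀) :
    ∃ c C Λ₀ : ℝ, 0 < c ∧ c ≤ C ∧
      ∀ Λ : ℕ, Λ₀ ≤ (Λ : ℝ) → ∀ (M : ℕ) (κ₀ : ℝ),
        scaleSeq Λ q M ^ (2 * β / (q + 1)) / 2 ≤ κ₀ →
        κ₀ ≤ 2 * scaleSeq Λ q M ^ (2 * β / (q + 1)) →
      ∀ κ : ℕ → ℝ, (∀ n, 0 < κ n) → κ M = κ₀ →
        (∀ n, 1 ≤ n → n + 1 ≤ M →
          modelDiffusivity (fun j => scaleSeq Λ q j ^ (β - 2)) (scaleSeq Λ q) M κ₀ (n + 1) / 2 ≤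
            κ (n + 1) →
          κ (n + 1) ≤
            2 * modelDiffusivity (fun j => scaleSeq Λ q j ^ (β - 2)) (scaleSeq Λ q) M κ₀ (n + 1) →
          |κ n - enhanceStep (scaleSeq Λ q (n + 1) ^ (β - 2)) (scaleSeq Λ q (n + 1)) (κ (n + 1))| ≤
            C₀ * scaleSeq Λ q n ^ σ *
              enhanceStep (scaleSeq Λ q (n + 1) ^ (β - 2)) (scaleSeq Λ q (n + 1)) (κ (n + 1))) →
        ∀ m : ℕ, 1 ≤ m → m < M →
          c * (scaleSeq Λ q m ^ (β - 2) * scaleSeq Λ q m ^ (2 + gammaExp β q)) ≤ κ m ∧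
            κ m ≤ C * (scaleSeq Λ q m ^ (β - 2) * scaleSeq Λ q m ^ (2 + gammaExp β q)) := by
  have hΚ0 : (0 : ℝ) ≤ max 10 (4 * q) := le_trans (by norm_num) (le_max_left _ _)
  obtain ⟨c, C, η, hc, hcC, hη, h⟩ := perturbedDiffusivity_bounds_general hβ hq hΚ0 hσ hC₀
  refine ⟨c, C, max (max 128 (52 * q)) (1 / η), hc, hcC, fun Λ hΛ => ?_⟩
  have h128 : (128 : ℝ) ≤ Λ := le_trans (le_trans (le_max_left _ _) (le_max_left _ _)) hΛ
  have h52 : 52 * q ≤ (Λ : ℝ) := le_trans (le_trans (le_max_right _ _) (le_max_left _ _)) hΛ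
  have hinv : 1 / η ≤ (Λ : ℝ) := le_trans (le_max_right _ _) hΛ
  have h27 : (2 : ℝ) ^ 7 = 128 := by norm_num
  have hΛr : (2 : ℝ) ^ 7 ≤ Λ := by rw [h27]; exact h128
  have hΛn : 2 ^ 7 ≤ Λ := by exact_mod_cast hΛr
  have hΛ0 : (0 : ℝ) < Λ := by linarith
  refine h (scaleSeq Λ q) ?_ ?_ ?_ ?_ ?_ ?_
  · exact scaleSeq_pos (by omega)
  · exact scaleSeq_zero Λ q
  · intro n
    calc (2 : ℝ) ^ 7 * scaleSeq Λ q (n + 1) ≤ Λ * scaleSeq Λ q (n + 1) :=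
          mul_le_mul_of_nonneg_right hΛr (scaleSeq_pos (by omega) _).le
      _ ≤ scaleSeq Λ q n := scaleSeq_ratio (by omega) hq n
  · intro n hn
    exact scaleSeq_superGeometric_max hq (by linarith) hn
  · intro n hn
    have hΚΛ : max 10 (4 * q) ≤ 10 / 128 * Λ := max_le (by linarith) (by linarith)
    have hε : scaleSeq Λ q n ≤ 1 / (Λ : ℝ) := scaleSeq_le_inv (by omega) hq hn
    calc max 10 (4 * q) * scaleSeq Λ q n ≤ (10 / 128 * Λ) * (1 / Λ) :=
          mul_le_mul hΚΛ hε (scaleSeq_pos (by omega) _).le (by positivity)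
      _ = 10 / 128 := by field_simp
  · calc scaleSeq Λ q 1 ≤ 1 / (Λ : ℝ) := scaleSeq_le_inv (by omega) hq le_rfl
      _ ≤ 1 / (1 / η) := one_div_le_one_div_of_le (by positivity) hinv
      _ = η := one_div_one_div η

end Scales

end ArmstrongVicol2025

end Literature.Analysis.FluidPDE
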